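import Literature.GroupTheory.CombinatorialGroupTheory.RibbonGraphDarts
import Literature.GroupTheory.CombinatorialGroupTheory.PermutationCycleSurgery
import HarnessLib

/-!
# Deleting an edge of a one-vertex ribbon graph: the new rotation and the new boundary cycles

Topic `Literature/GroupTheory/CombinatorialGroupTheory`; continues `RibbonGraphDarts.lean`.
Deleting the edge `e` (darts `h = (e, true)`, `h̄ = (e, false)`) from a one-vertex ribbon graph
with rotation `ρ` gives the rotation "`ρ` with `h, h̄` skipped" — realised on ALL darts as
`delPerm ρ e := skip (skip ρ h) h̄` where `skip σ b := swap b (σ b) ∘ σ` makes `b` a fixed point and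
lets its predecessor jump over it (`skip_apply_of_ne`).  The new face permutation
`delFace ρ e := delPerm ρ e ∘ flip` is, away from `h, h̄`, the old one with the two darts cut out
and the loose ends RE-PAIRED CROSSWISE (`delFace_apply_of_face_eq_fst/snd`: the predecessor of
`h` now goes to the successor of `h̄` and vice versa).  Consequently (the two cases of the
classical "cutting along an edge" computation, e.g. Mohar–Thomassen, *Graphs on Surfaces*
(2001) §3.3–3.4, or Zieschang–Vogt–Coldewey LNM 835 §3.1–3.2):

* `merge_*` — if `h`, `h̄` lie on DIFFERENT boundary cycles `h·P` and `h̄·Q`, these become ONE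
  cycle `P·Q` of `delFace`, with boundary word `U · V` where the old words were `e · U` and
  `e⁻¹ · V`;
* `split_*` — if they lie on the SAME cycle `h·P·h̄·Q`, it becomes TWO cycles `P` and `Q`, with
  words `U`, `V` where the old word was `e · U · e⁻¹ · V`;
* `others_*` — all other boundary cycles and words are unchanged;
* `delPerm_sameCycle` — `delPerm` is transitive away from `h, h̄` if `ρ` is (first-return map).

Everything here is stated on the darts of `E`; the transport to the dart type of `E ∖ {e}` is in
`RibbonGraphEdgeDeletionTransport.lean`.
-/

namespace Literature.GroupTheory.CombinatorialGroupTheory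

namespace RibbonGraph

open Equiv Equiv.Perm Function

universe u v

/-! ### Skipping a point of a permutation -/

section Skip

variable {α : Type v} [DecidableEq α] (σ : Perm α)

/-- `skip σ b`: the permutation agreeing with `σ` except that `b` is fixed and the predecessor of
`b` is sent to the successor of `b`. [cite: ZieschangVogtColdewey1980, 3.1.6] -/
def skip (b : α) : Perm α := swap b (σ b) * σ

/-- `skip_apply_self`: bookkeeping lemma of this construction (see the module docstring). [cite: ZieschangVogtColdewey1980, 3.1.6] -/
@[simp] theorem skip_apply_self (b : α) : skip σ b b = b := by
  simp [skip, swap_apply_right]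

/-- `skip_apply_of_ne`: bookkeeping lemma of this construction (see the module docstring). [cite: ZieschangVogtColdewey1980, 3.1.6] -/
theorem skip_apply_of_ne {b x : α} (hx : x ≠ b) :
    skip σ b x = if σ x = b then σ b else σ x := by
  simp only [skip, Perm.mul_apply]
  by_cases h : σ x = b
  · rw [if_pos h, h, swap_apply_left]
  · rw [if_neg h, swap_apply_of_ne_of_ne h fun h' => hx (σ.injective h')]

/-- Skipping two points. [cite: ZieschangVogtColdewey1980, 3.1.6] -/
def skip2 (a b : α) : Perm α := skip (skip σ a) b

variable {σ}

/-- `skip2_apply_snd`: bookkeeping lemma of this construction (see the module docstring). [cite: ZieschangVogtColdewey1980, 3.1.6] -/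
@[simp] theorem skip2_apply_snd (a b : α) : skip2 σ a b b = b := skip_apply_self _ b

/-- `skip2_apply_fst`: bookkeeping lemma of this construction (see the module docstring). [cite: ZieschangVogtColdewey1980, 3.1.6] -/
@[simp] theorem skip2_apply_fst {a b : α} (hab : a ≠ b) : skip2 σ a b a = a := by
  rw [skip2, skip_apply_of_ne _ hab, skip_apply_self, if_neg hab]

/-- Outside `{a, b}`, `skip2 σ a b` stays outside `{a, b}`. [cite: ZieschangVogtColdewey1980, 3.1.6] -/
theorem skip2_apply_ne_fst {a b x : α} (hab : a ≠ b) (hxa : x ≠ a) : skip2 σ a b x ≠ a :=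
  fun h => hxa ((skip2 σ a b).injective (h.trans (skip2_apply_fst hab).symm))

/-- `skip2_apply_ne_snd`: bookkeeping lemma of this construction (see the module docstring). [cite: ZieschangVogtColdewey1980, 3.1.6] -/
theorem skip2_apply_ne_snd {a b x : α} (hxb : x ≠ b) : skip2 σ a b x ≠ b :=
  fun h => hxb ((skip2 σ a b).injective (h.trans (skip2_apply_snd a b).symm))

/-- First-return description of `skip2`, first branch: the next point is already outside `{a, b}`.
[cite: ZieschangVogtColdewey1980, 3.1.6] -/
theorem skip2_apply_of_apply_ne {a b x : α} (hxa : x ≠ a) (hxb : x ≠ b) (ha : σ x ≠ a)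
    (hb : σ x ≠ b) : skip2 σ a b x = σ x := by
  rw [skip2, skip_apply_of_ne _ hxb, skip_apply_of_ne _ hxa, if_neg ha, if_neg hb]

/-- First-return description of `skip2`, second branch: the next point is `a`. [cite: ZieschangVogtColdewey1980, 3.1.6] -/
theorem skip2_apply_of_apply_eq_fst {a b x : α} (hab : a ≠ b) (hxa : x ≠ a) (hxb : x ≠ b)
    (ha : σ x = a) :
    (σ a ≠ b → skip2 σ a b x = σ a) ∧ (σ a = b → skip2 σ a b x = σ b) := by
  have h1 : skip σ a x = σ a := by rw [skip_apply_of_ne _ hxa, if_pos ha]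
  have hσa : σ a ≠ a := fun h => hxa (σ.injective (ha.trans h.symm))
  constructor
  · intro hσab
    rw [skip2, skip_apply_of_ne _ hxb, h1, if_neg hσab]
  · intro hσab
    have hσb : σ b ≠ a := fun h => hxb (σ.injective (ha.trans h.symm))
    have h2 : skip σ a b = σ b := by rw [skip_apply_of_ne _ hab.symm, if_neg hσb]
    rw [skip2, skip_apply_of_ne _ hxb, h1, if_pos hσab, h2]

/-- First-return description of `skip2`, third branch: the next point is `b`. [cite: ZieschangVogtColdewey1980, 3.1.6] -/
theorem skip2_apply_of_apply_eq_snd {a b x : α} (hab : a ≠ b) (hxa : x ≠ a) (hxb : x ≠ b)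
    (hb : σ x = b) :
    (σ b ≠ a → skip2 σ a b x = σ b) ∧ (σ b = a → skip2 σ a b x = σ a) := by
  have h1 : skip σ a x = b := by rw [skip_apply_of_ne _ hxa, if_neg (hb ▸ hab.symm), hb]
  constructor
  · intro hσba
    have h2 : skip σ a b = σ b := by rw [skip_apply_of_ne _ hab.symm, if_neg hσba]
    rw [skip2, skip_apply_of_ne _ hxb, h1, if_pos rfl, h2]
  · intro hσba
    have h2 : skip σ a b = σ a := by rw [skip_apply_of_ne _ hab.symm, if_pos hσba]
    rw [skip2, skip_apply_of_ne _ hxb, h1, if_pos rfl, h2]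

end Skip

/-! ### Deleting the edge `e`: the new rotation and face permutation on the old darts -/

section Delete

variable {E : Type u} [DecidableEq E] (ρ : Perm (Dart E)) (e : E)

/-- The rotation after deleting the edge `e`, realised on all darts (the two darts of `e` become
fixed points). [cite: ZieschangVogtColdewey1980, 3.1.6] -/
def delPerm : Perm (Dart E) := skip2 ρ (e, true) (e, false)

/-- The face permutation after deleting the edge `e`, realised on all darts. [cite: ZieschangVogtColdewey1980, 3.1.6] -/
def delFace : Perm (Dart E) := delPerm ρ e * flip

omit [DecidableEq E] in
/-- `dart_fst_ne_iff`: bookkeeping lemma of this construction (see the module docstring). [cite: ZieschangVogtColdewey1980, 3.1.6] -/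
theorem dart_fst_ne_iff (d : Dart E) : d.1 ≠ e ↔ d ≠ (e, true) ∧ d ≠ (e, false) := by
  rcases d with ⟨x, b⟩
  constructor
  · intro h; exact ⟨fun h' => h (Prod.mk.inj h').1, fun h' => h (Prod.mk.inj h').1⟩
  · rintro ⟨h1, h2⟩ h; subst h; cases b <;> simp_all

/-- `delPerm_apply_true`: bookkeeping lemma of this construction (see the module docstring). [cite: ZieschangVogtColdewey1980, 3.1.6] -/
@[simp] theorem delPerm_apply_true : delPerm ρ e (e, true) = (e, true) :=
  skip2_apply_fst (by simp)

/-- `delPerm_apply_false`: bookkeeping lemma of this construction (see the module docstring). [cite: ZieschangVogtColdewey1980, 3.1.6] -/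
@[simp] theorem delPerm_apply_false : delPerm ρ e (e, false) = (e, false) :=
  skip2_apply_snd _ _

/-- `delPerm_apply_fst_ne`: bookkeeping lemma of this construction (see the module docstring). [cite: ZieschangVogtColdewey1980, 3.1.6] -/
theorem delPerm_apply_fst_ne {d : Dart E} (hd : d.1 ≠ e) : (delPerm ρ e d).1 ≠ e := by
  rw [dart_fst_ne_iff] at hd ⊢
  exact ⟨skip2_apply_ne_fst (by simp) hd.1, skip2_apply_ne_snd hd.2⟩

/-- `delFace_apply`: bookkeeping lemma of this construction (see the module docstring). [cite: ZieschangVogtColdewey1980, 3.1.6] -/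
@[simp] theorem delFace_apply (d : Dart E) : delFace ρ e d = delPerm ρ e (flip d) := rfl

/-- `delFace_apply_fst_ne`: bookkeeping lemma of this construction (see the module docstring). [cite: ZieschangVogtColdewey1980, 3.1.6] -/
theorem delFace_apply_fst_ne {d : Dart E} (hd : d.1 ≠ e) : (delFace ρ e d).1 ≠ e :=
  delPerm_apply_fst_ne ρ e (d := flip d) (by simpa using hd)

/-- Away from `e`, where the next boundary dart is not a dart of `e`, the boundary walk is
unchanged. [cite: ZieschangVogtColdewey1980, 3.1.6] -/
theorem delFace_apply_of_face_fst_ne {d : Dart E} (hd : d.1 ≠ e) (h : (face ρ d).1 ≠ e) :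
    delFace ρ e d = face ρ d := by
  have hd' : (flip d).1 ≠ e := by simpa using hd
  rw [dart_fst_ne_iff] at hd' h
  exact skip2_apply_of_apply_ne hd'.1 hd'.2 h.1 h.2

/-- Where the old boundary walk would continue with `h = (e, true)`, the new one continues with
the old successor of `h̄ = (e, false)` — or, if `h̄` was a boundary cycle by itself, with the old
successor of `h`. [cite: ZieschangVogtColdewey1980, 3.1.6] -/
theorem delFace_apply_of_face_eq_true {d : Dart E} (hd : d.1 ≠ e) (h : face ρ d = (e, true)) :
    (face ρ (e, false) ≠ (e, false) → delFace ρ e d = face ρ (e, false)) ∧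
      (face ρ (e, false) = (e, false) → delFace ρ e d = face ρ (e, true)) := by
  have hd' : (flip d).1 ≠ e := by simpa using hd
  rw [dart_fst_ne_iff] at hd'
  have key := skip2_apply_of_apply_eq_fst (σ := ρ) (a := (e, true)) (b := (e, false)) (by simp)
    hd'.1 hd'.2 h
  simpa [delFace, delPerm, face_apply] using key

/-- Symmetrically for `h̄ = (e, false)`. [cite: ZieschangVogtColdewey1980, 3.1.6] -/
theorem delFace_apply_of_face_eq_false {d : Dart E} (hd : d.1 ≠ e) (h : face ρ d = (e, false)) :
    (face ρ (e, true) ≠ (e, true) → delFace ρ e d = face ρ (e, true)) ∧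
      (face ρ (e, true) = (e, true) → delFace ρ e d = face ρ (e, false)) := by
  have hd' : (flip d).1 ≠ e := by simpa using hd
  rw [dart_fst_ne_iff] at hd'
  have key := skip2_apply_of_apply_eq_snd (σ := ρ) (a := (e, true)) (b := (e, false)) (by simp)
    hd'.1 hd'.2 h
  simpa [delFace, delPerm, face_apply] using key

end Delete


/-! ### Transitivity is inherited; no fixed points -/

section Transitive

variable {E : Type u} [DecidableEq E] [Finite E] {ρ : Perm (Dart E)}

omit [DecidableEq E] [Finite E] in
/-- A transitive rotation has no fixed points (there are at least two darts). [cite: ZieschangVogtColdewey1980, 3.1.6] -/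
theorem IsTransitive.apply_ne_self (hρ : IsTransitive ρ) (d : Dart E) : ρ d ≠ d := by
  intro h
  obtain ⟨i, hi⟩ := hρ d (flip d)
  rw [zpow_apply_eq_self_of_apply_eq_self h] at hi
  exact flip_ne_self d hi.symm

omit [DecidableEq E] [Finite E] in
/-- For a transitive rotation, the boundary successor of `h = (e, true)` is not `h̄ = (e, false)`.
[cite: ZieschangVogtColdewey1980, 3.1.6] -/
theorem IsTransitive.face_true_ne_false (hρ : IsTransitive ρ) (e : E) :
    face ρ (e, true) ≠ (e, false) := by
  simpa using hρ.apply_ne_self (e, false)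

omit [DecidableEq E] [Finite E] in
/-- For a transitive rotation, the boundary successor of `h̄` is not `h`. [cite: ZieschangVogtColdewey1980, 3.1.6] -/
theorem IsTransitive.face_false_ne_true (hρ : IsTransitive ρ) (e : E) :
    face ρ (e, false) ≠ (e, true) := by
  simpa using hρ.apply_ne_self (e, true)

omit [DecidableEq E] in
/-- For a transitive rotation on at least two edges, the two darts of `e` are not both boundary
cycles by themselves. [cite: ZieschangVogtColdewey1980, 3.1.6] -/
theorem IsTransitive.not_face_fixed_both (hρ : IsTransitive ρ) {e e' : E} (hee' : e' ≠ e)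
    (h1 : face ρ (e, true) = (e, true)) : face ρ (e, false) ≠ (e, false) := by
  intro h2
  have h1' : ρ (e, false) = (e, true) := by simpa using h1
  have h2' : ρ (e, true) = (e, false) := by simpa using h2
  have hT : ∀ y ∈ ({(e, true), (e, false)} : Set (Dart E)), ρ y ∈ ({(e, true), (e, false)} : Set _) := by
    intro y hy
    simp only [Set.mem_insert_iff, Set.mem_singleton_iff] at hy ⊢
    rcases hy with rfl | rfl
    · exact Or.inr h2'
    · exact Or.inl h1'
  have hmem := SameCycle.mem_of_forall_apply_mem hT (u := (e, true)) (by simp) (hρ (e, true) (e', true))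
  simp only [Set.mem_insert_iff, Set.mem_singleton_iff, Prod.mk.injEq] at hmem
  rcases hmem with ⟨h, -⟩ | ⟨h, -⟩ <;> exact hee' h

variable (ρ) in
omit [Finite E] in
/-- `delPerm ρ e` is the first-return map of `ρ` to the darts not on `e`. [cite: ZieschangVogtColdewey1980, 3.1.6] -/
theorem delPerm_eq_firstReturn (e : E) {o : Dart E} (ho : o.1 ≠ e) :
    let m : ℕ := if (ρ o).1 ≠ e then 1 else if (ρ (ρ o)).1 ≠ e then 2 else 3
    (ρ ^ m) o = delPerm ρ e o ∧ (∀ k, 1 ≤ k → k < m → ((ρ ^ k) o).1 = e) := by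
  intro m
  have ho' := (dart_fst_ne_iff e o).1 ho
  by_cases h1 : (ρ o).1 ≠ e
  · have hm : m = 1 := by simp [m, h1]
    rw [hm]
    refine ⟨?_, fun k hk hk' => by omega⟩
    rw [pow_one, delPerm, skip2_apply_of_apply_ne ho'.1 ho'.2 ((dart_fst_ne_iff e _).1 h1).1
      ((dart_fst_ne_iff e _).1 h1).2]
  · rw [not_ne_iff] at h1
    -- `ρ o` is a dart of `e`
    have hρo : ρ o = (e, true) ∨ ρ o = (e, false) := by
      rcases hρo : ρ o with ⟨x, b⟩
      rw [hρo] at h1; simp only at h1; subst h1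
      cases b <;> simp
    by_cases h2 : (ρ (ρ o)).1 ≠ e
    · have hm : m = 2 := by simp [m, h1, h2]
      rw [hm]
      have h2' := (dart_fst_ne_iff e _).1 h2
      refine ⟨?_, fun k hk hk' => ?_⟩
      · rw [pow_two, Perm.mul_apply, delPerm]
        rcases hρo with h | h
        · have key := (skip2_apply_of_apply_eq_fst (σ := ρ) (by simp) ho'.1 ho'.2 h).1
          rw [h] at h2' ⊢; exact (key h2'.2).symm
        · have key := (skip2_apply_of_apply_eq_snd (σ := ρ) (by simp) ho'.1 ho'.2 h).1
          rw [h] at h2' ⊢; exact (key h2'.1).symm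
      · obtain rfl : k = 1 := by omega
        rwa [pow_one]
    · rw [not_ne_iff] at h2
      have hm : m = 3 := by simp [m, h1, h2]
      rw [hm]
      refine ⟨?_, fun k hk hk' => ?_⟩
      · rw [pow_succ, pow_two, Perm.mul_apply, Perm.mul_apply, delPerm]
        rcases hρo with h | h
        · -- `ρ o = h`, `ρ h ∈ B`, hence `ρ h = h̄`
          have hρh : ρ (e, true) = (e, false) := by
            rw [h] at h2
            rcases hρh : ρ (e, true) with ⟨x, b⟩
            rw [hρh] at h2; simp only at h2; subst h2
            cases b
            · rfl
            · exfalso; exact ho'.1 (ρ.injective (h.trans hρh.symm))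
          have key := (skip2_apply_of_apply_eq_fst (σ := ρ) (by simp) ho'.1 ho'.2 h).2 hρh
          rw [h, hρh]; exact key.symm
        · have hρh : ρ (e, false) = (e, true) := by
            rw [h] at h2
            rcases hρh : ρ (e, false) with ⟨x, b⟩
            rw [hρh] at h2; simp only at h2; subst h2
            cases b
            · exfalso; exact ho'.2 (ρ.injective (h.trans hρh.symm))
            · rfl
          have key := (skip2_apply_of_apply_eq_snd (σ := ρ) (by simp) ho'.1 ho'.2 h).2 hρh
          rw [h, hρh]; exact key.symm
      · rcases (show k = 1 ∨ k = 2 by omega) with rfl | rfl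
        · rwa [pow_one]
        · rwa [pow_two, Perm.mul_apply]

/-- Deleting an edge of a ONE-vertex ribbon graph leaves a one-vertex ribbon graph: `delPerm ρ e`
is transitive on the darts not on `e`. [cite: ZieschangVogtColdewey1980, 3.1.6] -/
theorem IsTransitive.delPerm_sameCycle (hρ : IsTransitive ρ) (e : E) {x z : Dart E} (hx : x.1 ≠ e)
    (hz : z.1 ≠ e) : (delPerm ρ e).SameCycle x z := by
  let m : Dart E → ℕ := fun o => if (ρ o).1 ≠ e then 1 else if (ρ (ρ o)).1 ≠ e then 2 else 3
  refine sameCycle_of_firstReturn (φ := ρ) (D := {d : Dart E | d.1 = e}) m (fun o _ => ?_)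
    (fun o ho => (delPerm_eq_firstReturn ρ e ho).1) (fun o ho k hk hk' => ?_)
    (fun o ho => delPerm_apply_fst_ne ρ e ho) hx hz (hρ x z)
  · simp only [m]; split_ifs <;> omega
  · exact (delPerm_eq_firstReturn ρ e ho).2 k hk hk'

end Transitive

end RibbonGraph

end Literature.GroupTheory.CombinatorialGroupTheory
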